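import Literature.Topology.FourManifolds.NonSeparatingSpheres
import Literature.Topology.FourManifolds.TorusCoordinates
import Literature.Topology.FourManifolds.ClosedBallProofs
import Literature.Topology.FourManifolds.DehnSurgeryTubularNbhdProofs
import HarnessLib

/-!
# Budney–Gabai Thm. 3.13: the standard circles `z ↦ (e^{ia} z^{±1}, p₀)` of `S¹ × Sⁿ`

Companion to `Literature/Topology/FourManifolds/NonSeparatingSpheres.lean` (fact seat of
`Literature.Topology.FourManifolds.BudneyGabai2019_thm_3_13`; R. Budney, D. Gabai, *Knotted
3-balls in `S⁴`*, arXiv:1912.09029, Thm. 3.13, proof p. 22: *"we can isotope our embedding to be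
equal to `S¹ × {*}`"*).  The target of that isotopy, the circle `S¹ × {p₀}`, is parametrised in
the tree by the loops `s ↦ (e^{ia} ι(s)^d, p₀)` of `NonSeparatingSpheresLoopHomotopy.lean`
(`ι = toCircle : 𝕊¹ → Circle`, `d = ±1` the degree, `a` a phase).  This file shows that these are
**smoothly embedded circles with image `S¹ × {p₀}`**:

* `contMDiff_toCircle`, `isSmoothEmbedding_toCircle` — the identification
  `toCircle : 𝕊¹ → Circle`, `(x, y) ↦ x + iy` (`TorusCoordinates.lean`) is a smooth embedding
  (indeed a diffeomorphism; its smooth left inverse is `z ↦ (re z, im z)`), and surjective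
  (`toCircle_surjective`);
* `BudneyGabai2019_thm_3_13.isSmoothEmbedding_standardLoop`,
  `BudneyGabai2019_thm_3_13.range_standardLoop` — for `d = ±1`, `s ↦ (e^{ia} ι(s)^d, p₀)` is a
  smooth embedding `𝕊¹ → S¹ × Sⁿ` with image `S¹ × {p₀}` (it is the embedding `s ↦ (ι s, p₀)`
  followed by the self-diffeomorphism `(z, p) ↦ (e^{ia} z^{±1}, p)` of the Lie group factor).

Everything here is proved; no definition and no named fact is introduced.

## References

* R. Budney, D. Gabai, *Knotted 3-balls in `S⁴`*, arXiv:1912.09029 (v2), §3, proof of Thm. 3.13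
  (p. 22). [BudneyGabai2019]
* M. W. Hirsch, *Differential Topology*, GTM 33 (1976), Ch. 1 §3, Thm. 3.1. [HirschDT1976]
-/

noncomputable section

open scoped Manifold ContDiff Topology Real
open Set Function Metric Module

namespace Literature.Topology.FourManifolds

/-! ### `toCircle : 𝕊¹ → Circle` is a diffeomorphism onto `Circle` -/

/-- `toCircle : 𝕊¹ → Circle` is smooth (`toC` is linear; restrict to the spheres). [folklore] -/
theorem contMDiff_toCircle : ContMDiff (𝓡 1) (𝓡 1) ∞ toCircle :=
  haveI : Fact (finrank ℝ ℂ = 1 + 1) := finrank_real_complex_fact'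
  haveI : Fact (finrank ℝ (EuclideanSpace ℝ (Fin 2)) = 1 + 1) := ⟨finrank_euclideanSpace_fin⟩
  (contDiff_toC.contMDiff.comp contMDiff_coe_sphere).codRestrict_sphere _

/-- `toCircle : 𝕊¹ → Circle` is surjective (`toCircle (cos θ, sin θ) = e^{iθ}` and `exp` is onto).
[folklore] -/
theorem toCircle_surjective : Surjective toCircle := fun z ↦ by
  refine ⟨circlePoint (Complex.arg (z : ℂ)), ?_⟩
  conv_rhs => rw [← Circle.exp_arg z]
  apply Circle.ext
  rw [coe_toCircle, Circle.coe_exp]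
  apply Complex.ext
  · rw [toC_re, circlePoint_apply_zero, Complex.exp_ofReal_mul_I_re]
  · rw [toC_im, circlePoint_apply_one, Complex.exp_ofReal_mul_I_im]

/-- **`toCircle : 𝕊¹ → Circle` is a smooth embedding** (injective, and its differential is
injective because `z ↦ (re z, im z)` is a smooth left inverse; the tree's criterion
`isSmoothEmbedding_of_injective_of_injective_mfderiv`). [folklore] -/
theorem isSmoothEmbedding_toCircle : Manifold.IsSmoothEmbedding (𝓡 1) (𝓡 1) ∞ toCircle := by
  haveI : Fact (finrank ℝ ℂ = 1 + 1) := finrank_real_complex_fact'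
  haveI : Fact (finrank ℝ (EuclideanSpace ℝ (Fin 2)) = 1 + 1) := ⟨finrank_euclideanSpace_fin⟩
  refine isSmoothEmbedding_of_injective_of_injective_mfderiv contMDiff_toCircle (by simp)
    toCircle_injective fun u ↦ ?_
  -- the left inverse `z ↦ (re z, im z) ∈ ℝ²`, as a map `Circle → ℝ²`
  set L : Circle → EuclideanSpace ℝ (Fin 2) :=
    fun z ↦ WithLp.toLp 2 ![(z : ℂ).re, (z : ℂ).im] with hL
  have hLs : ContMDiff (𝓡 1) 𝓘(ℝ, EuclideanSpace ℝ (Fin 2)) ∞ L := by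
    have h1 : ContDiff ℝ ∞ (fun z : ℂ ↦ (WithLp.toLp 2 ![z.re, z.im] : EuclideanSpace ℝ (Fin 2))) := by
      rw [contDiff_euclidean]
      intro i
      fin_cases i
      · simp only [Fin.zero_eta, Matrix.cons_val_zero]
        exact Complex.reCLM.contDiff
      · simp only [Fin.mk_one, Matrix.cons_val_one, Matrix.cons_val_fin_one]
        exact Complex.imCLM.contDiff
    exact h1.contMDiff.comp contMDiff_coe_sphere
  have hcomp : L ∘ toCircle = fun u : Metric.sphere (0 : EuclideanSpace ℝ (Fin 2)) 1 ↦
      ((u : EuclideanSpace ℝ (Fin 2)) : EuclideanSpace ℝ (Fin 2)) := by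
    funext v
    simp only [comp_apply, hL, coe_toCircle, toC_re, toC_im]
    ext i
    fin_cases i <;> simp
  have hchain : mfderiv (𝓡 1) 𝓘(ℝ, EuclideanSpace ℝ (Fin 2))
      (fun u : Metric.sphere (0 : EuclideanSpace ℝ (Fin 2)) 1 ↦ (u : EuclideanSpace ℝ (Fin 2))) u =
      (mfderiv (𝓡 1) 𝓘(ℝ, EuclideanSpace ℝ (Fin 2)) L (toCircle u)).comp
        (mfderiv (𝓡 1) (𝓡 1) toCircle u) := by
    rw [← hcomp]
    exact mfderiv_comp u (hLs.mdifferentiableAt (by simp))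
      (contMDiff_toCircle.mdifferentiableAt (by simp))
  have hinj := mfderiv_coe_sphere_injective (E := EuclideanSpace ℝ (Fin 2)) (n := 1) u
  rw [hchain] at hinj
  have key : Injective (⇑(mfderiv (𝓡 1) 𝓘(ℝ, EuclideanSpace ℝ (Fin 2)) L (toCircle u)) ∘
      ⇑(mfderiv (𝓡 1) (𝓡 1) toCircle u)) := hinj
  exact key.of_comp

namespace BudneyGabai2019_thm_3_13

variable {n : ℕ}

/-- The embedding `s ↦ (ι s, p₀) : 𝕊¹ → S¹ × Sⁿ` (`ι = toCircle`) is a smooth embedding.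
[folklore] -/
theorem isSmoothEmbedding_toCircle_prodMk_const
    (p₀ : Metric.sphere (0 : EuclideanSpace ℝ (Fin (n + 1))) 1) :
    Manifold.IsSmoothEmbedding (𝓡 1) ((𝓡 1).prod (𝓡 n)) ∞
      (fun s : Metric.sphere (0 : EuclideanSpace ℝ (Fin 2)) 1 ↦ ((toCircle s, p₀) :
        Circle × Metric.sphere (0 : EuclideanSpace ℝ (Fin (n + 1))) 1)) := by
  refine isSmoothEmbedding_of_injective_of_injective_mfderiv
    (contMDiff_toCircle.prodMk contMDiff_const) (by simp)
    (fun s t h ↦ toCircle_injective (congrArg Prod.fst h)) fun s ↦ ?_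
  rw [mfderiv_prodMk (contMDiff_toCircle.mdifferentiableAt (by simp)) mdifferentiableAt_const]
  intro v w hvw
  have h1 : mfderiv (𝓡 1) (𝓡 1) toCircle s v = mfderiv (𝓡 1) (𝓡 1) toCircle s w :=
    congrArg Prod.fst hvw
  exact mfderiv_injective_of_isImmersion isSmoothEmbedding_toCircle.isImmersion (by simp) s h1

/-- The self-diffeomorphism `(z, p) ↦ (e^{ia} z, p)` of `S¹ × Sⁿ`, resp. `(z, p) ↦ (e^{ia} z⁻¹, p)`
(left translation and inversion in the Lie group `Circle`), packaged: for `d = ±1` there is a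
diffeomorphism `Φ` of `S¹ × Sⁿ` with `Φ (z, p) = (e^{ia} z^d, p)`. [folklore] -/
theorem exists_diffeomorph_twist (a : ℝ) {d : ℤ} (hd : d = 1 ∨ d = -1) :
    ∃ Φ : (Circle × Metric.sphere (0 : EuclideanSpace ℝ (Fin (n + 1))) 1) ≃ₘ⟮(𝓡 1).prod (𝓡 n),
        (𝓡 1).prod (𝓡 n)⟯ (Circle × Metric.sphere (0 : EuclideanSpace ℝ (Fin (n + 1))) 1),
      ∀ q, Φ q = (Circle.exp a * q.1 ^ d, q.2) := by
  rcases hd with rfl | rfl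
  · let T : Circle ≃ₘ⟮𝓡 1, 𝓡 1⟯ Circle :=
      { toEquiv := Equiv.mulLeft (Circle.exp a)
        contMDiff_toFun := contMDiff_mul_left
        contMDiff_invFun := contMDiff_mul_left }
    refine ⟨T.prodCongr (Diffeomorph.refl (𝓡 n) _ ∞), fun q ↦ ?_⟩
    simp only [Diffeomorph.coe_prodCongr, Diffeomorph.coe_refl, zpow_one]
    rfl
  · let T : Circle ≃ₘ⟮𝓡 1, 𝓡 1⟯ Circle :=
      { toEquiv := (Equiv.inv Circle).trans (Equiv.mulLeft (Circle.exp a))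
        contMDiff_toFun := contMDiff_mul_left.comp (contMDiff_inv (𝓡 1) ∞)
        contMDiff_invFun := (contMDiff_inv (𝓡 1) ∞).comp contMDiff_mul_left }
    refine ⟨T.prodCongr (Diffeomorph.refl (𝓡 n) _ ∞), fun q ↦ ?_⟩
    simp only [Diffeomorph.coe_prodCongr, Diffeomorph.coe_refl, zpow_neg, zpow_one]
    rfl

/-- **The standard loops of degree `±1` are smoothly embedded circles**: for `d = ±1`, a phase
`a` and `p₀ ∈ Sⁿ`, `s ↦ (e^{ia} ι(s)^d, p₀)` is a smooth embedding `𝕊¹ → S¹ × Sⁿ`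
(`s ↦ (ι s, p₀)` followed by the diffeomorphism of `exists_diffeomorph_twist`; the tree's
`Manifold.IsSmoothEmbedding.diffeomorph_comp`). [folklore] -/
theorem isSmoothEmbedding_standardLoop (a : ℝ) {d : ℤ} (hd : d = 1 ∨ d = -1)
    (p₀ : Metric.sphere (0 : EuclideanSpace ℝ (Fin (n + 1))) 1) :
    Manifold.IsSmoothEmbedding (𝓡 1) ((𝓡 1).prod (𝓡 n)) ∞
      (fun s : Metric.sphere (0 : EuclideanSpace ℝ (Fin 2)) 1 ↦ ((Circle.exp a * toCircle s ^ d, p₀) :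
        Circle × Metric.sphere (0 : EuclideanSpace ℝ (Fin (n + 1))) 1)) := by
  obtain ⟨Φ, hΦ⟩ := exists_diffeomorph_twist (n := n) a hd
  have h := (isSmoothEmbedding_toCircle_prodMk_const p₀).diffeomorph_comp Φ
  have heq : (Φ ∘ fun s : Metric.sphere (0 : EuclideanSpace ℝ (Fin 2)) 1 ↦ ((toCircle s, p₀) :
      Circle × Metric.sphere (0 : EuclideanSpace ℝ (Fin (n + 1))) 1)) =
      fun s ↦ ((Circle.exp a * toCircle s ^ d, p₀) :
        Circle × Metric.sphere (0 : EuclideanSpace ℝ (Fin (n + 1))) 1) := by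
    funext s
    rw [comp_apply, hΦ]
  rwa [heq] at h

/-- **The image of a standard loop of degree `±1` is the fibre circle `S¹ × {p₀}`.** [folklore] -/
theorem range_standardLoop (a : ℝ) {d : ℤ} (hd : d = 1 ∨ d = -1)
    (p₀ : Metric.sphere (0 : EuclideanSpace ℝ (Fin (n + 1))) 1) :
    range (fun s : Metric.sphere (0 : EuclideanSpace ℝ (Fin 2)) 1 ↦ ((Circle.exp a * toCircle s ^ d, p₀) :
        Circle × Metric.sphere (0 : EuclideanSpace ℝ (Fin (n + 1))) 1)) =
      (univ : Set Circle) ×ˢ ({p₀} : Set (Metric.sphere (0 : EuclideanSpace ℝ (Fin (n + 1))) 1)) := by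
  ext ⟨z, p⟩
  simp only [mem_range, Prod.mk.injEq, mem_prod, mem_univ, mem_singleton_iff, true_and]
  constructor
  · rintro ⟨s, -, hs⟩
    exact hs.symm
  · intro hp
    subst hp
    -- solve `e^{ia} ι(s)^d = z`
    obtain ⟨s, hs⟩ := toCircle_surjective (((Circle.exp a)⁻¹ * z) ^ d)
    refine ⟨s, ?_, rfl⟩
    rw [hs]
    rcases hd with rfl | rfl
    · simp
    · simp [mul_comm]

end BudneyGabai2019_thm_3_13

end Literature.Topology.FourManifolds

end
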